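import Summits.Ventures.PercRepro.Night2ExcessMassIndep

/-!
# PercRepro — the FAT-FACE BUDGET: the per-basis excess through the number of fat thin hyperplanes (night-2, gen 23)

The chord bound of gen 20 charges every face of a covering basis `Q` through the linear majorant of `1/(m + d)`.
This file charges the faces through what they ARE: only the faces `Q ∖ w` that are thin members carry a request
(`L1_le_sum_memberFaces`), a member face missing `≤ 2` points is a FAT thin member whose closure is one of the
closures of the fat thin members of `G`, distinct faces have distinct closures (`card_fatFaces_le_card_fatClosures`),
and every other member face misses `≥ 3` points.  Hence, if the fat thin members of `G` have at most `k` distinct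
closures, the face losses of every covering basis sum to at most

  `fatBudget q d ρ k = Φ · (k/(2 + d) + (ρ − k)/(3 + d)) − capDG`

(`sum_faceLoss_le_budget`, `sum_faceLoss_budget_union_le`).  At `(3, 0)` this is `37/180 = 0.206` for `k = 1`,
`11/45 = 0.244` for `k = 2`, `29/90 = 0.322` for `k = 4` against the chord `0.342 / 0.296 / 0.260 / 0.230` at
`n = 10 / 11 / 12 / 13` — the cells of `Night2FatBudgetCells`.
-/

namespace PercRepro.Shadow

open Finset PerFlat ThmH

/-- The fat-face budget `Φ · (k/(2 + d) + (ρ − k)/(3 + d)) − capDG`. -/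
noncomputable def fatBudget (q d ρ k : ℕ) : ℚ :=
  phiQ q * ((k : ℚ) / (2 + (d : ℚ)) + ((ρ : ℚ) - (k : ℚ)) / (3 + (d : ℚ))) - capDG q d 0

/-- `fatBudget 5 3 6 1 = 37/180`. -/
theorem fatBudget_three_zero_one : fatBudget 5 3 6 1 = (37 / 180 : ℚ) := by
  unfold fatBudget capDG phiQ; norm_num

/-- `fatBudget 5 3 6 2 = 11/45`. -/
theorem fatBudget_three_zero_two : fatBudget 5 3 6 2 = (11 / 45 : ℚ) := by
  unfold fatBudget capDG phiQ; norm_num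

/-- `fatBudget 5 3 6 4 = 29/90`. -/
theorem fatBudget_three_zero_four : fatBudget 5 3 6 4 = (29 / 90 : ℚ) := by
  unfold fatBudget capDG phiQ; norm_num

variable {α : Type*} [DecidableEq α] {M : Matroid α} [M.Finite]

open scoped Classical in
/-- The closures of the thin members of `G` missing at most `m` points. -/
noncomputable def fatClosures (M : Matroid α) [M.Finite] (q : ℕ) (G : Finset α) (m : ℕ) : Finset (Finset α) :=
  ((thinMembers M q G).filter (fun B => (G \ clF M B).card ≤ m)).image (clF M)

open scoped Classical in
/-- **`L1 Q ≤ Φ Σ_{w : Q ∖ w thin member} 1/(m_w + d)`**: only the faces that are thin members request. -/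
theorem L1_le_sum_memberFaces {q d : ℕ} {G : Finset α} (hG : G ∈ flatsQ M (q + 1)) (hd : (gr M \ G).card = d)
    (hd1 : 1 ≤ d) (hdq : d ≤ q) {Q : Finset α} (hQ : Q ∈ shadowAt M (q + 2) q (Uq M (q + 2) q) G) :
    L1 M q G Q ≤ phiQ q * ∑ w ∈ (Q \ coloops M G).filter (fun w => Q.erase w ∈ thinMembers M q G),
      1 / (((G \ clF M (Q.erase w)).card : ℚ) + (d : ℚ)) := by
  have hd' : (gr M \ G).card ≤ q := by omega
  have hQG : Q ⊆ G := subset_G_of_mem_shadowAt hQ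
  have hsub1 := thin_coverPreimages_subset_image_coloops hG hd' Q
  set W := (Q \ coloops M G).filter (fun w => Q.erase w ∈ thinMembers M q G) with hW
  have hsub : (coverPreimages M (Uq M (q + 2) q) G Q).filter (fun B => B ∉ lay0 M q G) ⊆
      Finset.image (fun w => Q.erase w) W := by
    intro B hB
    have hB' := hsub1 hB
    rw [Finset.mem_image] at hB' ⊢
    obtain ⟨w, hw, rfl⟩ := hB'
    refine ⟨w, ?_, rfl⟩
    rw [hW, Finset.mem_filter]
    refine ⟨(mem_coloops.1 hw).1, ?_⟩
    rw [Finset.mem_filter] at hB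
    exact mem_thinMembers.2 ⟨(mem_coverPreimages.1 hB.1).1, hB.2⟩
  unfold L1
  calc ∑ B ∈ (coverPreimages M (Uq M (q + 2) q) G Q).filter (fun B => B ∉ lay0 M q G), req M q B
      ≤ ∑ B ∈ Finset.image (fun w => Q.erase w) W, req M q B :=
        Finset.sum_le_sum_of_subset_of_nonneg hsub (fun B _ _ => req_nonneg q B)
    _ = ∑ w ∈ W, req M q (Q.erase w) := by
        apply Finset.sum_image
        intro w hw w' hw' heq
        have hwQ : w ∈ Q := (Finset.mem_sdiff.1 (Finset.mem_filter.1 hw).1).1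
        have hwQ' : w' ∈ Q := (Finset.mem_sdiff.1 (Finset.mem_filter.1 hw').1).1
        exact Finset.erase_injOn Q hwQ hwQ' heq
    _ ≤ ∑ w ∈ W, phiQ q / (((G \ clF M (Q.erase w)).card : ℚ) + (d : ℚ)) := by
        apply Finset.sum_le_sum
        intro w _
        exact req_le_of_subset_G hG hd hd1 ((Finset.erase_subset w Q).trans hQG)
    _ = phiQ q * ∑ w ∈ W, 1 / (((G \ clF M (Q.erase w)).card : ℚ) + (d : ℚ)) := by
        rw [Finset.mul_sum]
        apply Finset.sum_congr rfl
        intro w _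
        rw [mul_one_div]

open scoped Classical in
/-- **Distinct fat member faces have distinct closures among the fat thin closures of `G`**: the number of faces
`Q ∖ w` (`w ∈ Q ∖ K`) that are thin members missing `≤ m` points is at most `#fatClosures`. -/
theorem card_fatFaces_le_card_fatClosures {q ρ m : ℕ} {G : Finset α} (hG : G ∈ flatsQ M (q + 1))
    (hk : kColoops M G + ρ = q + 1) {Q : Finset α} (hQ : Q ∈ shadowAt M (q + 2) q (Uq M (q + 2) q) G)
    (hQc : (Q \ coloops M G).card = ρ) :
    ((Q \ coloops M G).filter
      (fun w => Q.erase w ∈ thinMembers M q G ∧ (G \ clF M (Q.erase w)).card ≤ m)).card ≤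
      (fatClosures M q G m).card := by
  have hQG : Q ⊆ G := subset_G_of_mem_shadowAt hQ
  have hGg : G ⊆ gr M := (mem_flatsQ.1 hG).1
  apply Finset.card_le_card_of_injOn (fun w => clF M (Q.erase w))
  · intro w hw
    rw [Finset.mem_coe, Finset.mem_filter] at hw
    unfold fatClosures
    rw [Finset.mem_coe, Finset.mem_image]
    exact ⟨Q.erase w, Finset.mem_filter.2 ⟨hw.2.1, hw.2.2⟩, rfl⟩
  · intro w hw w' hw' heq
    rw [Finset.mem_coe, Finset.mem_filter] at hw hw'
    have hwQ : w ∈ Q := (Finset.mem_sdiff.1 hw.1).1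
    have hwQ' : w' ∈ Q := (Finset.mem_sdiff.1 hw'.1).1
    by_contra hne
    -- `w' ∈ Q ∖ w ⊆ cl (Q ∖ w) = cl (Q ∖ w')`, but `w' ∉ cl (Q ∖ w')`
    have h1 : w' ∈ clF M (Q.erase w) := by
      apply subset_clF_of_subset_gr ((Finset.erase_subset w Q).trans (hQG.trans hGg))
      exact Finset.mem_erase.2 ⟨fun h => hne h.symm, hwQ'⟩
    have h2 := mem_sdiff_clF_erase_self hk hQ hQc hwQ'
    simp only at heq
    rw [heq] at h1
    exact (Finset.mem_sdiff.1 h2).2 h1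

open scoped Classical in
/-- **THE FAT-FACE BUDGET**: if at most `k ≤ ρ` faces of the covering basis `Q` are thin members missing `≤ 2`
points (`k ≤ ρ` is not needed), the face losses of `Q` sum to at most
`fatBudget q d ρ k = Φ (k/(2+d) + (ρ−k)/(3+d)) − capDG` (every other member face misses `≥ 3` points; `kColoops = 0`). -/
theorem sum_faceLoss_le_budget {q d ρ k : ℕ} {G : Finset α} (hG : G ∈ flatsQ M (q + 1))
    (hd : (gr M \ G).card = d) (hdq : d ≤ q) (hk : kColoops M G + ρ = q + 1) (hk0 : kColoops M G = 0)
    (hd1 : 1 ≤ d) (hE : 0 ≤ fatBudget q d ρ k)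
    {Q : Finset α} (hQ : Q ∈ shadowAt M (q + 2) q (Uq M (q + 2) q) G) (hQc : (Q \ coloops M G).card = ρ)
    (hfat : ((Q \ coloops M G).filter
      (fun w => Q.erase w ∈ thinMembers M q G ∧ (G \ clF M (Q.erase w)).card ≤ 2)).card ≤ k) :
    ∑ w ∈ Q \ coloops M G, faceLoss M q G Q w ≤ fatBudget q d ρ k := by
  have hd' : (gr M \ G).card ≤ q := by omega
  have hQG : Q ⊆ G := subset_G_of_mem_shadowAt hQ
  have hcap : 0 ≤ capS M q G Q := capS_nonneg' hG hd' Q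
  have hcapDG : capDG q d (kColoops M G) ≤ capS M q G Q := by
    unfold capDG; exact capS_ge_one_sub_kColoops (q := q) hd hQG
  rw [hk0] at hcapDG
  set W := (Q \ coloops M G).filter (fun w => Q.erase w ∈ thinMembers M q G) with hW
  set F := (Q \ coloops M G).filter
    (fun w => Q.erase w ∈ thinMembers M q G ∧ (G \ clF M (Q.erase w)).card ≤ 2) with hF
  have hFW : F ⊆ W := by
    intro w hw
    rw [hF, Finset.mem_filter] at hw
    rw [hW, Finset.mem_filter]
    exact ⟨hw.1, hw.2.1⟩
  have hWQ : W ⊆ Q \ coloops M G := Finset.filter_subset _ _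
  have hWcard : W.card ≤ ρ := by rw [← hQc]; exact Finset.card_le_card hWQ
  -- the face sum of the member faces
  have hd2 : (0 : ℚ) < 2 + (d : ℚ) := by positivity
  have hd3 : (0 : ℚ) < 3 + (d : ℚ) := by positivity
  have hsplit : ∑ w ∈ W, 1 / (((G \ clF M (Q.erase w)).card : ℚ) + (d : ℚ)) ≤
      (F.card : ℚ) / (2 + (d : ℚ)) + ((W.card : ℚ) - (F.card : ℚ)) / (3 + (d : ℚ)) := by
    rw [← Finset.sum_sdiff hFW]
    have hFsum : ∑ w ∈ F, 1 / (((G \ clF M (Q.erase w)).card : ℚ) + (d : ℚ)) ≤ (F.card : ℚ) / (2 + (d : ℚ)) := by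
      calc ∑ w ∈ F, 1 / (((G \ clF M (Q.erase w)).card : ℚ) + (d : ℚ))
          ≤ ∑ _w ∈ F, 1 / (2 + (d : ℚ)) := by
            apply Finset.sum_le_sum
            intro w hw
            have hm : 2 ≤ (G \ clF M (Q.erase w)).card :=
              two_le_card_face hk hQ hQc (Finset.mem_filter.1 hw).1
            apply one_div_le_one_div_of_le hd2
            have : (2 : ℚ) ≤ ((G \ clF M (Q.erase w)).card : ℚ) := by exact_mod_cast hm
            linarith
        _ = (F.card : ℚ) / (2 + (d : ℚ)) := by rw [Finset.sum_const, nsmul_eq_mul, mul_one_div]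
    have hRsum : ∑ w ∈ W \ F, 1 / (((G \ clF M (Q.erase w)).card : ℚ) + (d : ℚ)) ≤
        ((W.card : ℚ) - (F.card : ℚ)) / (3 + (d : ℚ)) := by
      calc ∑ w ∈ W \ F, 1 / (((G \ clF M (Q.erase w)).card : ℚ) + (d : ℚ))
          ≤ ∑ _w ∈ W \ F, 1 / (3 + (d : ℚ)) := by
            apply Finset.sum_le_sum
            intro w hw
            rw [Finset.mem_sdiff] at hw
            have hwW := hw.1
            rw [hW, Finset.mem_filter] at hwW
            have hm : 3 ≤ (G \ clF M (Q.erase w)).card := by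
              by_contra hlt
              push Not at hlt
              apply hw.2
              rw [hF, Finset.mem_filter]
              exact ⟨hwW.1, hwW.2, by omega⟩
            apply one_div_le_one_div_of_le hd3
            have : (3 : ℚ) ≤ ((G \ clF M (Q.erase w)).card : ℚ) := by exact_mod_cast hm
            linarith
        _ = ((W.card : ℚ) - (F.card : ℚ)) / (3 + (d : ℚ)) := by
            rw [Finset.sum_const, nsmul_eq_mul, mul_one_div, Finset.card_sdiff_of_subset hFW]
            have : (F.card : ℚ) ≤ (W.card : ℚ) := by exact_mod_cast Finset.card_le_card hFW
            push_cast [Finset.card_le_card hFW]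
            ring
    linarith
  -- the fatBudget is increasing in the number of fat faces
  have hmono : (F.card : ℚ) / (2 + (d : ℚ)) + ((W.card : ℚ) - (F.card : ℚ)) / (3 + (d : ℚ)) ≤
      (k : ℚ) / (2 + (d : ℚ)) + ((ρ : ℚ) - (k : ℚ)) / (3 + (d : ℚ)) := by
    have hFk : (F.card : ℚ) ≤ (k : ℚ) := by exact_mod_cast hfat
    have hWρ : (W.card : ℚ) ≤ (ρ : ℚ) := by exact_mod_cast hWcard
    have hgap : 1 / (3 + (d : ℚ)) ≤ 1 / (2 + (d : ℚ)) := one_div_le_one_div_of_le hd2 (by linarith)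
    have e1 : (F.card : ℚ) / (2 + (d : ℚ)) + ((W.card : ℚ) - (F.card : ℚ)) / (3 + (d : ℚ)) =
        (F.card : ℚ) * (1 / (2 + (d : ℚ)) - 1 / (3 + (d : ℚ))) + (W.card : ℚ) * (1 / (3 + (d : ℚ))) := by
      field_simp
      ring
    have e2 : (k : ℚ) / (2 + (d : ℚ)) + ((ρ : ℚ) - (k : ℚ)) / (3 + (d : ℚ)) =
        (k : ℚ) * (1 / (2 + (d : ℚ)) - 1 / (3 + (d : ℚ))) + (ρ : ℚ) * (1 / (3 + (d : ℚ))) := by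
      field_simp
      ring
    rw [e1, e2]
    have h3pos : (0 : ℚ) ≤ 1 / (3 + (d : ℚ)) := by positivity
    have := mul_le_mul_of_nonneg_right hFk (sub_nonneg.2 hgap)
    have := mul_le_mul_of_nonneg_right hWρ h3pos
    linarith
  have hL1 : L1 M q G Q ≤ phiQ q * ((k : ℚ) / (2 + (d : ℚ)) + ((ρ : ℚ) - (k : ℚ)) / (3 + (d : ℚ))) :=
    (L1_le_sum_memberFaces hG hd hd1 hdq hQ).trans
      (mul_le_mul_of_nonneg_left (hsplit.trans hmono) (phiQ_pos q).le)
  calc ∑ w ∈ Q \ coloops M G, faceLoss M q G Q w ≤ L1 M q G Q * (1 - fS M q G Q) :=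
        sum_faceLoss_le_L1_mul hG hd' Q
    _ ≤ max 0 (L1 M q G Q - capS M q G Q) := L1_mul_one_sub_fS_le hcap
    _ ≤ fatBudget q d ρ k := by
        apply max_le hE
        unfold fatBudget
        linarith

open scoped Classical in
/-- The fat-face budget for a covering basis `K ∪ T` given through its `ρ`-subset `T` of the target (the
version `localShadowHall_excess_of_count` consumes): if the fat thin members of `G` have at most `k` distinct
closures, every covering basis loses at most `fatBudget q d ρ k`. -/
theorem sum_faceLoss_budget_union_le {q d ρ k : ℕ} {G : Finset α} (hG : G ∈ flatsQ M (q + 1))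
    (hd : (gr M \ G).card = d) (hdq : d ≤ q) (hk : kColoops M G + ρ = q + 1) (hk0 : kColoops M G = 0)
    (hd1 : 1 ≤ d) (hE : 0 ≤ fatBudget q d ρ k)
    (hcl : (fatClosures M q G 2).card ≤ k)
    {S : Finset α} {T : Finset α} (hT : T ∈ (S \ coloops M G).powersetCard ρ) :
    ∑ w ∈ T, faceLoss M q G (coloops M G ∪ T) w ≤ fatBudget q d ρ k := by
  have hd' : (gr M \ G).card ≤ q := by omega
  rw [Finset.mem_powersetCard] at hT
  obtain ⟨hTS, hTc⟩ := hT
  have hTK : Disjoint (coloops M G) T := by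
    rw [Finset.disjoint_left]
    intro x hx hxT
    exact (Finset.mem_sdiff.1 (hTS hxT)).2 hx
  have hQc : ((coloops M G ∪ T) \ coloops M G).card = ρ := by
    rw [Finset.union_sdiff_cancel_left hTK, hTc]
  have hQT : (coloops M G ∪ T) \ coloops M G = T := Finset.union_sdiff_cancel_left hTK
  by_cases hQ : coloops M G ∪ T ∈ shadowAt M (q + 2) q (Uq M (q + 2) q) G
  · have hfat := (card_fatFaces_le_card_fatClosures (m := 2) hG hk hQ hQc).trans hcl
    have := sum_faceLoss_le_budget hG hd hdq hk hk0 hd1 hE hQ hQc hfat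
    rwa [hQT] at this
  · have hzero : ∀ w ∈ T, faceLoss M q G (coloops M G ∪ T) w = 0 := by
      intro w hw
      unfold faceLoss
      rw [if_neg]
      rintro ⟨hthin, hwc⟩
      apply hQ
      have := insert_mem_shadowAt_thin hG hthin hwc
      rwa [Finset.insert_erase (Finset.mem_union_right _ hw)] at this
    rw [Finset.sum_eq_zero hzero]
    exact hE

end PercRepro.Shadow
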